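import Summits.BirchSwinnertonDyer.BirchSwinnertonDyer.Theorems.ManinLocalTwoThreeHexagonalSqueezeThirtySix
import Summits.BirchSwinnertonDyer.BirchSwinnertonDyer.Theorems.ManinLocalTwoThreeEtaIdentityReductionTwentySeven
import HarnessLib

/-!
# Reduction of the level-36 `η`-identities to three `q`-asymptotics at `i∞`

Cell bsd-f2-manin, route `ManinLocalTwoThree` (C2 `ManinOddAtFour` stmt-22967, C3 `ManinPrimeToThreeAtNine`
stmt-22968: `4 ∣ 36`, `9 ∣ 36`), prover seat p2 gen 26; port of p3 g22's `EtaIdentityReduction` (`N = 27`)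
and -an g49's Sketch-an-g49d (`N = 32`) to `N = 36`, the analytic debt (S2)₃₆ of
`HexagonalSqueezeThirtySix.abs_maninConstant_eq_one_thirtySix_of_periodLattice_le_hex`.

OBJECTS (tree `etaQuotient 36 (expFn …)`; found by solving Ligozat's cusp-order system at level `36` and
certified in exact arithmetic to `O(q⁷⁰)` — seat folder `scripts/etasearch36.py`, `scripts/rel36.py`):
`x = η(12τ)η(18τ)³/(η(6τ)η(36τ)³) = q⁻² + q⁴ + ⋯` (the `x`-coordinate of `X₀(36) → 36a1 : y² = x³ + 1`, zeros at
the cusps `1/9, 1/18`), `Y = η(12τ)⁴η(18τ)²/(η(6τ)²η(36τ)⁴) = q⁻³ + 2q³ + ⋯` (the `y`-coordinate, zeros at the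
three `2`-torsion cusps), `φ₃₆ = η(6τ)⁴` (`cuspFormEtaProductThirtySix`).
IDENTITIES: (I1) `Y² = x³ + 1`; (I2a) `x′ = −2πi φ₃₆ · 2Y`; (I2b) `Y′ = −2πi φ₃₆ · 3x²`; hence
`(x′)² = (2πiφ₃₆)²(4x³ + 4)`, the Weierstrass equation with `(g₂, g₃) = (0, −4)`.

* §1 THE CUSP-FORM ARGUMENT at a general level `N` (p3's `deriv_eq_of_tendsto`, parametrised): for
  `φ ∈ S₂(Γ₀(N))` and holomorphic `Γ₀(N)`-invariant `x, y` bounded at the cusps off `∞`, `R = (2πi)⁻¹x′ + φ·y`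
  is a cusp form once `R → 0` at `i∞`; if every `S ∈ S₂(Γ₀(N))` with `S/q → 0` vanishes, `x′ = −2πi φ y`.
* §2 `x, Y` are `Γ₀(36)`-invariant (Newman) and bounded at every cusp off `∞` (Ligozat orders `≥ 0`).
* §3 THE REDUCTION: the three limits (T1) `((2πi)⁻¹x′ + φ₃₆·2Y)/q → 0`, (T2) `((2πi)⁻¹Y′ + φ₃₆·3x²)/q → 0`,
  (T3) `x³ + 1 − Y² → 0` at `i∞` give (I2a), (I2b), (I1) (the cubic has zero derivative), then (S2)₃₆
  `Λ(φ₃₆) ⊆ Λ(0, −4)` by the tree's analytic bridge (`AnalyticBridge.periodLattice_le_of_deriv_sq`), and **`|c(D)| = 1`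
  for every globally minimal `W` and every `X₀(36)`-datum with the lattice clause** — all modulo (T1)–(T3).

HONEST FRAMING: no modularity binder, no CDT, no printed Manin fact; the only hypotheses are the three
`q`-limits.  Nothing here proves C2, C3, Manin's conjecture or BSD.  No definition, no named fact, no sorry.
[cite: Ligozat1975, Ch. 4] [cite: Koehler2011, §1] [cite: CremonaAlgorithms1997, §2.10] [cite: DiamondShurman2005, §1.2, Thm. 3.5.1]
-/

set_option autoImplicit false
-- lint-debt: the directory name repeats the summit name (sibling precedent `ManinLocalTwoThreeEtaIdentityReductionTwentySeven.lean`)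
set_option linter.dupNamespace false

noncomputable section

open Complex Filter Topology Set Function Asymptotics
open UpperHalfPlane hiding I
open scoped Real Topology Manifold MatrixGroups ModularForm
open ModularForm CongruenceSubgroup
open Literature.NumberTheory.EllipticCurves Literature.NumberTheory.EllipticCurves.ModularForms

namespace Summit.BirchSwinnertonDyer.BirchSwinnertonDyer.Theorems.ManinLocalTwoThree.EtaIdentityReductionThirtySix

open CuspToolkit AnalyticBridge EtaIdentityReduction

/-! ## §1 The cusp-form argument at a general level `N` -/

section General

variable {N : ℕ} [NeZero N]

omit [NeZero N] in
/-- `(R|₂A)(τ) = (2πi)⁻¹ (x∘A)′(τ) + (φ|₂A)(τ) · y(Aτ)` for `R = (2πi)⁻¹x′ + φ·y`. [folklore] -/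
theorem slash_two_apply_of (φ : CuspForm (Gamma0 N) 2) {x : ℍ → ℂ} (y : ℍ → ℂ)
    (hx : MDifferentiable 𝓘(ℂ) 𝓘(ℂ) x) (A : SL(2, ℤ)) (τ : ℍ) :
    ((fun σ : ℍ ↦ (2 * π * I)⁻¹ * deriv (x ∘ ofComplex) σ + φ σ * y σ) ∣[(2 : ℤ)] A) τ
      = (2 * π * I)⁻¹ * deriv ((fun σ : ℍ ↦ x (A • σ)) ∘ ofComplex) τ
        + (⇑φ ∣[(2 : ℤ)] A) τ * y (A • τ) := by
  rw [SL_slash_apply, SL_slash_apply, ModularGroup.denom_apply, deriv_comp_smul_ofComplex hx A τ]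
  have hJ : ((A 1 0 : ℤ) : ℂ) * (τ : ℂ) + ((A 1 1 : ℤ) : ℂ) ≠ 0 := SL2_denom_ne_zero A τ
  rw [zpow_neg, zpow_ofNat]
  field_simp

/-- **`R = (2πi)⁻¹x′ + φ·y` is a cusp form on `Γ₀(N)`** when `φ ∈ S₂(Γ₀(N))`, `x, y` are holomorphic and
`Γ₀(N)`-invariant, `x∘γ`, `y∘γ` are bounded at `i∞` off `Γ₀(N)`, and `R → 0` at `i∞` (at the other cusps
`(x∘γ)′ → 0` by Cauchy's estimate and `φ|γ → 0`). [cite: DiamondShurman2005, §1.2] -/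
theorem exists_cuspForm_of (φ : CuspForm (Gamma0 N) 2) (x y : ℍ → ℂ) (hx : MDifferentiable 𝓘(ℂ) 𝓘(ℂ) x)
    (hy : MDifferentiable 𝓘(ℂ) 𝓘(ℂ) y)
    (hxinv : ∀ γ : SL(2, ℤ), γ ∈ Gamma0 N → ∀ τ : ℍ, x (γ • τ) = x τ)
    (hyinv : ∀ γ : SL(2, ℤ), γ ∈ Gamma0 N → ∀ τ : ℍ, y (γ • τ) = y τ)
    (hxb : ∀ γ : SL(2, ℤ), γ ∉ Gamma0 N → IsBoundedAtImInfty (fun τ : ℍ ↦ x (γ • τ)))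
    (hyb : ∀ γ : SL(2, ℤ), γ ∉ Gamma0 N → IsBoundedAtImInfty (fun τ : ℍ ↦ y (γ • τ)))
    (h0 : IsZeroAtImInfty (fun σ : ℍ ↦ (2 * π * I)⁻¹ * deriv (x ∘ ofComplex) σ + φ σ * y σ)) :
    ∃ S : CuspForm (Gamma0 N) 2, ∀ τ : ℍ, S τ = (2 * π * I)⁻¹ * deriv (x ∘ ofComplex) τ + φ τ * y τ := by
  have hdiffx := UpperHalfPlane.mdifferentiable_iff.mp hx
  have hφinv : ∀ γ : SL(2, ℤ), γ ∈ Gamma0 N → (⇑φ ∣[(2 : ℤ)] γ) = ⇑φ := fun γ hγ ↦ by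
    have h := SlashInvariantForm.slash_action_eqn φ _ ⟨γ, hγ, rfl⟩
    rw [SL_slash]
    exact h
  refine ⟨{ toFun := fun σ : ℍ ↦ (2 * π * I)⁻¹ * deriv (x ∘ ofComplex) σ + φ σ * y σ
            slash_action_eq' := ?_
            holo' := ?_
            zero_at_cusps' := ?_ }, fun τ ↦ rfl⟩
  · intro A hA
    obtain ⟨γ, hγ, rfl⟩ := hA
    funext τ
    show ((fun σ : ℍ ↦ (2 * π * I)⁻¹ * deriv (x ∘ ofComplex) σ + φ σ * y σ) ∣[(2 : ℤ)] γ) τ = _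
    rw [slash_two_apply_of φ y hx γ τ, hφinv γ hγ, hyinv γ hγ τ,
      show (fun σ : ℍ ↦ x (γ • σ)) = x from funext (hxinv γ hγ)]
  · rw [UpperHalfPlane.mdifferentiable_iff]
    have hD : DifferentiableOn ℂ (deriv (x ∘ ofComplex)) {z : ℂ | 0 < z.im} :=
      (hdiffx.analyticOnNhd isOpen_upperHalfPlaneSet).deriv.differentiableOn
    have hφ := UpperHalfPlane.mdifferentiable_iff.mp (CuspFormClass.holo φ)
    have hy' := UpperHalfPlane.mdifferentiable_iff.mp hy
    have h : DifferentiableOn ℂ (fun z : ℂ ↦ (2 * π * I)⁻¹ * deriv (x ∘ ofComplex) z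
        + (φ ∘ ofComplex) z * (y ∘ ofComplex) z) {z : ℂ | 0 < z.im} :=
      (hD.const_mul _).add (hφ.mul hy')
    refine h.congr fun z hz ↦ ?_
    simp only [Function.comp_apply, ofComplex_apply_of_im_pos hz]
    rfl
  · intro c hc
    rw [Subgroup.IsArithmetic.isCusp_iff_isCusp_SL2Z] at hc
    rw [OnePoint.isZeroAt_iff_forall_SL2Z hc]
    intro A _
    show IsZeroAtImInfty ((fun σ : ℍ ↦ (2 * π * I)⁻¹ * deriv (x ∘ ofComplex) σ + φ σ * y σ) ∣[(2 : ℤ)] A)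
    have hfun : ((fun σ : ℍ ↦ (2 * π * I)⁻¹ * deriv (x ∘ ofComplex) σ + φ σ * y σ) ∣[(2 : ℤ)] A)
        = fun τ : ℍ ↦ (2 * π * I)⁻¹ * deriv ((fun σ : ℍ ↦ x (A • σ)) ∘ ofComplex) τ
          + (⇑φ ∣[(2 : ℤ)] A) τ * y (A • τ) :=
      funext (slash_two_apply_of φ y hx A)
    rw [hfun]
    by_cases hA : A ∈ Gamma0 N
    · have hxA : (fun σ : ℍ ↦ x (A • σ)) = x := funext (hxinv A hA)
      simp_rw [hxA, hφinv A hA, hyinv A hA]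
      exact h0
    · have h1 : IsZeroAtImInfty (fun τ : ℍ ↦ deriv ((fun σ : ℍ ↦ x (A • σ)) ∘ ofComplex) τ) :=
        isZeroAtImInfty_deriv_of_isBoundedAtImInfty (CuspToolkit.mdifferentiable_comp_smul hx A) (hxb A hA)
      have h2 : IsZeroAtImInfty (⇑φ ∣[(2 : ℤ)] A) := CuspFormClass.zero_at_infty_slash φ A
      have h3 : IsZeroAtImInfty (fun τ : ℍ ↦ (⇑φ ∣[(2 : ℤ)] A) τ * y (A • τ)) :=
        h2.mul_boundedAtFilter (hyb A hA)
      have h4 : IsZeroAtImInfty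
          (fun τ : ℍ ↦ (2 * π * I)⁻¹ * deriv ((fun σ : ℍ ↦ x (A • σ)) ∘ ofComplex) τ) :=
        (const_boundedAtFilter atImInfty ((2 * π * I)⁻¹ : ℂ)).mul_zeroAtFilter h1
      exact h4.add h3

/-- **The cusp-form argument at level `N`**: if every `S ∈ S₂(Γ₀(N))` with `S/q → 0` vanishes, then
`((2πi)⁻¹x′ + φ·y)/q → 0` at `i∞` forces `x′ = −2πi φ y` on `ℍ`. [cite: DiamondShurman2005, §1.2, Thm. 3.5.1] -/
theorem deriv_eq_of_tendsto_of (φ : CuspForm (Gamma0 N) 2)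
    (hS0 : ∀ S : CuspForm (Gamma0 N) 2,
      Tendsto (fun τ : ℍ ↦ S τ / Function.Periodic.qParam 1 (τ : ℂ)) atImInfty (𝓝 0) → S = 0)
    (x y : ℍ → ℂ) (hx : MDifferentiable 𝓘(ℂ) 𝓘(ℂ) x) (hy : MDifferentiable 𝓘(ℂ) 𝓘(ℂ) y)
    (hxinv : ∀ γ : SL(2, ℤ), γ ∈ Gamma0 N → ∀ τ : ℍ, x (γ • τ) = x τ)
    (hyinv : ∀ γ : SL(2, ℤ), γ ∈ Gamma0 N → ∀ τ : ℍ, y (γ • τ) = y τ)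
    (hxb : ∀ γ : SL(2, ℤ), γ ∉ Gamma0 N → IsBoundedAtImInfty (fun τ : ℍ ↦ x (γ • τ)))
    (hyb : ∀ γ : SL(2, ℤ), γ ∉ Gamma0 N → IsBoundedAtImInfty (fun τ : ℍ ↦ y (γ • τ)))
    (hlim : Tendsto (fun τ : ℍ ↦ ((2 * π * I)⁻¹ * deriv (x ∘ ofComplex) τ + φ τ * y τ)
      / Function.Periodic.qParam 1 (τ : ℂ)) atImInfty (𝓝 0)) :
    ∀ τ : ℍ, deriv (x ∘ ofComplex) τ = -(2 * π * I * φ τ) * y τ := by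
  obtain ⟨S, hS⟩ := exists_cuspForm_of φ x y hx hy hxinv hyinv hxb hyb
    (isZeroAtImInfty_of_tendsto_div_qParam hlim)
  have hS' : S = 0 := by
    refine hS0 S (hlim.congr fun τ ↦ ?_)
    rw [hS τ]
  intro τ
  have h := hS τ
  rw [hS', CuspForm.zero_apply] at h
  have h2pi : (2 * π * I : ℂ) ≠ 0 := by simp [Real.pi_ne_zero, I_ne_zero]
  have h' : deriv (x ∘ ofComplex) τ
      = (2 * π * I) * ((2 * π * I)⁻¹ * deriv (x ∘ ofComplex) τ + φ τ * y τ) - 2 * π * I * φ τ * y τ := by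
    field_simp
    ring
  rw [h', ← h]
  ring

end General

/-! ## §2 `x, Y` are `Γ₀(36)`-invariant and bounded at every cusp off `∞` -/

/-- Newman's conditions for `x = η₆⁻¹η₁₂η₁₈³η₃₆⁻³` in weight `0`: `Σ r = 0`, `Σ δr = −48`, `Σ (36/δ) r = 0`,
`∏ δ^{|r|} = 6·12·18³·36³ = 2¹²3¹⁴ = (2⁶3⁷)²`. [folklore] -/
theorem newmanCond_x36 : NewmanCond 36 (expFn [(6, -1), (12, 1), (18, 3), (36, -3)]) 0 :=
  ⟨by decide, by decide, by decide, ⟨2 ^ 6 * 3 ^ 7, by decide⟩⟩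

/-- Newman's conditions for `Y = η₆⁻²η₁₂⁴η₁₈²η₃₆⁻⁴` in weight `0`: `Σ r = 0`, `Σ δr = −72`, `Σ (36/δ) r = 0`,
`∏ δ^{|r|} = (6·12²·18·36²)²`. [folklore] -/
theorem newmanCond_Y36 : NewmanCond 36 (expFn [(6, -2), (12, 4), (18, 2), (36, -4)]) 0 :=
  ⟨by decide, by decide, by decide, ⟨6 * 12 ^ 2 * 18 * 36 ^ 2, by decide⟩⟩

/-- `x(γτ) = x(τ)` for `γ ∈ Γ₀(36)`. [folklore] -/
theorem x36_smul (γ : Gamma0 36) (τ : ℍ) :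
    etaQuotient 36 (expFn [(6, -1), (12, 1), (18, 3), (36, -3)]) ((γ : SL(2, ℤ)) • τ)
      = etaQuotient 36 (expFn [(6, -1), (12, 1), (18, 3), (36, -3)]) τ := by
  have h := etaQuotient_smul_of_mem_Gamma0 36 (by norm_num) _ 0 ⟨0, by simp⟩ newmanCond_x36 γ.2 τ
  rwa [zpow_zero, one_mul] at h

/-- `Y(γτ) = Y(τ)` for `γ ∈ Γ₀(36)`. [folklore] -/
theorem Y36_smul (γ : Gamma0 36) (τ : ℍ) :
    etaQuotient 36 (expFn [(6, -2), (12, 4), (18, 2), (36, -4)]) ((γ : SL(2, ℤ)) • τ)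
      = etaQuotient 36 (expFn [(6, -2), (12, 4), (18, 2), (36, -4)]) τ := by
  have h := etaQuotient_smul_of_mem_Gamma0 36 (by norm_num) _ 0 ⟨0, by simp⟩ newmanCond_Y36 γ.2 τ
  rwa [zpow_zero, one_mul] at h

/-- Ligozat's order at level `36` is `≥ 0` at every `c` with `36 ∤ c`, given the values at the proper
divisors `gcd(c, 36) ∈ {1, 2, 3, 4, 6, 9, 12, 18}`. [cite: Ligozat1975, Ch. 3] -/
theorem cuspOrder24_nonneg_of_not_dvd36 (r : ℕ → ℤ)
    (h : ∀ t ∈ Nat.divisors 36, t ≠ 36 → 0 ≤ cuspOrder24 36 r t) {c : ℤ} (hc : ¬ (36 : ℤ) ∣ c) :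
    0 ≤ cuspOrder24 36 r c := by
  rw [cuspOrder24_eq_gcd]
  refine h _ (Nat.mem_divisors.mpr ⟨Nat.gcd_dvd_left _ _, by norm_num⟩) fun h36 ↦ hc ?_
  have h36' : (36 : ℕ) ∣ c.natAbs := h36 ▸ Nat.gcd_dvd_right _ _
  exact Int.natCast_dvd.mpr h36'

/-- `γ ∉ Γ₀(36)` ⟹ `36 ∤ c(γ)`. [folklore] -/
theorem not_dvd_of_not_mem36 {γ : SL(2, ℤ)} (hγ : γ ∉ Gamma0 36) : ¬ (36 : ℤ) ∣ γ 1 0 := by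
  intro h
  apply hγ
  rw [Gamma0_mem]
  exact (ZMod.intCast_zmod_eq_zero_iff_dvd _ 36).mpr h

/-- `x ∘ γ` is bounded at `i∞` for `γ ∉ Γ₀(36)` (Ligozat orders `0,0,0,0,0,216,0,864`). [cite: Ligozat1975, Ch. 3] -/
theorem isBoundedAtImInfty_x36_smul {γ : SL(2, ℤ)} (hγ : γ ∉ Gamma0 36) :
    IsBoundedAtImInfty (fun τ : ℍ ↦ etaQuotient 36 (expFn [(6, -1), (12, 1), (18, 3), (36, -3)]) (γ • τ)) :=
  isBoundedAtImInfty_etaQuotient_smul 36 (by norm_num) _ (by decide) γ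
    (cuspOrder24_nonneg_of_not_dvd36 _ (by decide) (not_dvd_of_not_mem36 hγ))

/-- `Y ∘ γ` is bounded at `i∞` for `γ ∉ Γ₀(36)` (Ligozat orders `0,0,0,96,0,0,864,0`). [cite: Ligozat1975, Ch. 3] -/
theorem isBoundedAtImInfty_Y36_smul {γ : SL(2, ℤ)} (hγ : γ ∉ Gamma0 36) :
    IsBoundedAtImInfty (fun τ : ℍ ↦ etaQuotient 36 (expFn [(6, -2), (12, 4), (18, 2), (36, -4)]) (γ • τ)) :=
  isBoundedAtImInfty_etaQuotient_smul 36 (by norm_num) _ (by decide) γ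
    (cuspOrder24_nonneg_of_not_dvd36 _ (by decide) (not_dvd_of_not_mem36 hγ))

/-! ## §3 The three limits ⟹ the identities ⟹ (S2)₃₆ ⟹ `|c| = 1` on `X₀(36)` -/

/-- **(I2a) from (T1)**: `x′ = −2πi φ₃₆ · 2Y` on `ℍ`. [cite: Ligozat1975, Ch. 4] -/
theorem deriv_x36_of_tendsto
    (hT1 : Tendsto (fun τ : ℍ ↦ ((2 * π * I)⁻¹
      * deriv (etaQuotient 36 (expFn [(6, -1), (12, 1), (18, 3), (36, -3)]) ∘ ofComplex) τ
      + cuspFormEtaProductThirtySix τ * (2 * etaQuotient 36 (expFn [(6, -2), (12, 4), (18, 2), (36, -4)]) τ))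
      / Function.Periodic.qParam 1 (τ : ℂ)) atImInfty (𝓝 0)) :
    ∀ τ : ℍ, deriv (etaQuotient 36 (expFn [(6, -1), (12, 1), (18, 3), (36, -3)]) ∘ ofComplex) τ
      = -(2 * π * I * cuspFormEtaProductThirtySix τ)
          * (2 * etaQuotient 36 (expFn [(6, -2), (12, 4), (18, 2), (36, -4)]) τ) := by
  refine deriv_eq_of_tendsto_of cuspFormEtaProductThirtySix
    NewformThirtySix.cuspForm_thirtySix_eq_zero_of_tendsto _
    (fun τ ↦ 2 * etaQuotient 36 (expFn [(6, -2), (12, 4), (18, 2), (36, -4)]) τ)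
    (mdifferentiable_etaQuotient 36 _) ?_ (fun γ hγ τ ↦ x36_smul ⟨γ, hγ⟩ τ)
    (fun γ hγ τ ↦ by simp only [Y36_smul ⟨γ, hγ⟩ τ])
    (fun γ hγ ↦ isBoundedAtImInfty_x36_smul hγ) (fun γ hγ ↦ ?_) hT1
  · exact (mdifferentiable_etaQuotient 36 _).const_smul (2 : ℂ)
  · exact (isBoundedAtImInfty_Y36_smul hγ).const_mul_left 2

/-- **(I2b) from (T2)**: `Y′ = −2πi φ₃₆ · 3x²` on `ℍ`. [cite: Ligozat1975, Ch. 4] -/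
theorem deriv_Y36_of_tendsto
    (hT2 : Tendsto (fun τ : ℍ ↦ ((2 * π * I)⁻¹
      * deriv (etaQuotient 36 (expFn [(6, -2), (12, 4), (18, 2), (36, -4)]) ∘ ofComplex) τ
      + cuspFormEtaProductThirtySix τ * (3 * etaQuotient 36 (expFn [(6, -1), (12, 1), (18, 3), (36, -3)]) τ ^ 2))
      / Function.Periodic.qParam 1 (τ : ℂ)) atImInfty (𝓝 0)) :
    ∀ τ : ℍ, deriv (etaQuotient 36 (expFn [(6, -2), (12, 4), (18, 2), (36, -4)]) ∘ ofComplex) τ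
      = -(2 * π * I * cuspFormEtaProductThirtySix τ)
          * (3 * etaQuotient 36 (expFn [(6, -1), (12, 1), (18, 3), (36, -3)]) τ ^ 2) := by
  refine deriv_eq_of_tendsto_of cuspFormEtaProductThirtySix
    NewformThirtySix.cuspForm_thirtySix_eq_zero_of_tendsto _
    (fun τ ↦ 3 * etaQuotient 36 (expFn [(6, -1), (12, 1), (18, 3), (36, -3)]) τ ^ 2)
    (mdifferentiable_etaQuotient 36 _) ?_ (fun γ hγ τ ↦ Y36_smul ⟨γ, hγ⟩ τ)
    (fun γ hγ τ ↦ by simp only [x36_smul ⟨γ, hγ⟩ τ])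
    (fun γ hγ ↦ isBoundedAtImInfty_Y36_smul hγ) (fun γ hγ ↦ ?_) hT2
  · exact ((mdifferentiable_etaQuotient 36 _).pow 2).const_smul (3 : ℂ)
  · exact ((isBoundedAtImInfty_x36_smul hγ).mul (isBoundedAtImInfty_x36_smul hγ)
      |>.const_mul_left 3).congr_left fun τ ↦ by simp only [Pi.mul_apply]; ring

/-- **(I1) from (I2a), (I2b), (T3)**: `x³ + 1 = Y²` on `ℍ` — `(x³ + 1 − Y²)′ = 3x²·(−2Y) − 2Y·(−3x²) = 0`
identically (times `2πiφ₃₆`), so the cubic is constant, and it tends to `0` at `i∞`. [cite: Ligozat1975, Ch. 4] -/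
theorem cubic36_of_deriv
    (hx : ∀ τ : ℍ, deriv (etaQuotient 36 (expFn [(6, -1), (12, 1), (18, 3), (36, -3)]) ∘ ofComplex) τ
      = -(2 * π * I * cuspFormEtaProductThirtySix τ)
          * (2 * etaQuotient 36 (expFn [(6, -2), (12, 4), (18, 2), (36, -4)]) τ))
    (hy : ∀ τ : ℍ, deriv (etaQuotient 36 (expFn [(6, -2), (12, 4), (18, 2), (36, -4)]) ∘ ofComplex) τ
      = -(2 * π * I * cuspFormEtaProductThirtySix τ)
          * (3 * etaQuotient 36 (expFn [(6, -1), (12, 1), (18, 3), (36, -3)]) τ ^ 2))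
    (hT3 : Tendsto (fun τ : ℍ ↦ etaQuotient 36 (expFn [(6, -1), (12, 1), (18, 3), (36, -3)]) τ ^ 3 + 1
      - etaQuotient 36 (expFn [(6, -2), (12, 4), (18, 2), (36, -4)]) τ ^ 2) atImInfty (𝓝 0)) :
    ∀ τ : ℍ, etaQuotient 36 (expFn [(6, -1), (12, 1), (18, 3), (36, -3)]) τ ^ 3 + 1
      = etaQuotient 36 (expFn [(6, -2), (12, 4), (18, 2), (36, -4)]) τ ^ 2 := by
  set X : ℍ → ℂ := etaQuotient 36 (expFn [(6, -1), (12, 1), (18, 3), (36, -3)]) with hX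
  set Y : ℍ → ℂ := etaQuotient 36 (expFn [(6, -2), (12, 4), (18, 2), (36, -4)]) with hY
  have hXd := UpperHalfPlane.mdifferentiable_iff.mp
    (mdifferentiable_etaQuotient 36 (expFn [(6, -1), (12, 1), (18, 3), (36, -3)]))
  have hYd := UpperHalfPlane.mdifferentiable_iff.mp
    (mdifferentiable_etaQuotient 36 (expFn [(6, -2), (12, 4), (18, 2), (36, -4)]))
  have hderiv : ∀ z ∈ {z : ℂ | 0 < z.im}, deriv (fun z : ℂ ↦ (X ∘ ofComplex) z ^ 3 + 1
      - (Y ∘ ofComplex) z ^ 2) z = 0 := by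
    intro z hz
    have h1 : HasDerivAt (X ∘ ofComplex) (deriv (X ∘ ofComplex) z) z :=
      ((hXd z hz).differentiableAt (isOpen_upperHalfPlaneSet.mem_nhds hz)).hasDerivAt
    have h2 : HasDerivAt (Y ∘ ofComplex) (deriv (Y ∘ ofComplex) z) z :=
      ((hYd z hz).differentiableAt (isOpen_upperHalfPlaneSet.mem_nhds hz)).hasDerivAt
    have hPd := ((h1.pow 3).add_const (1 : ℂ)).sub (h2.pow 2)
    have hfun : (fun z : ℂ ↦ (X ∘ ofComplex) z ^ 3 + 1 - (Y ∘ ofComplex) z ^ 2)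
        = ((fun w ↦ (X ∘ ofComplex ^ 3) w + 1) - Y ∘ ofComplex ^ 2) := by
      funext w
      simp only [Pi.sub_apply, Pi.pow_apply]
    rw [hfun, hPd.deriv]
    have hx' := hx ⟨z, hz⟩
    have hy' := hy ⟨z, hz⟩
    have hcoe : ((⟨z, hz⟩ : ℍ) : ℂ) = z := rfl
    rw [hcoe] at hx' hy'
    simp only [Function.comp_apply, ofComplex_apply_of_im_pos hz]
    rw [hx', hy', show (3 : ℕ) - 1 = 2 from rfl, show (2 : ℕ) - 1 = 1 from rfl]
    push_cast
    ring
  have hPdiff : DifferentiableOn ℂ (fun z : ℂ ↦ (X ∘ ofComplex) z ^ 3 + 1 - (Y ∘ ofComplex) z ^ 2)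
      {z : ℂ | 0 < z.im} :=
    ((hXd.pow 3).add_const (1 : ℂ)).sub (hYd.pow 2)
  have hconst : ∀ z ∈ {z : ℂ | 0 < z.im}, ∀ w ∈ {z : ℂ | 0 < z.im},
      (fun z : ℂ ↦ (X ∘ ofComplex) z ^ 3 + 1 - (Y ∘ ofComplex) z ^ 2) z
        = (fun z : ℂ ↦ (X ∘ ofComplex) z ^ 3 + 1 - (Y ∘ ofComplex) z ^ 2) w :=
    fun z hz w hw ↦ isOpen_upperHalfPlaneSet.is_const_of_deriv_eq_zero
      convex_setOf_im_pos.isPreconnected hPdiff hderiv hz hw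
  intro τ
  have hlim : Tendsto (fun σ : ℍ ↦ X σ ^ 3 + 1 - Y σ ^ 2) atImInfty (𝓝 (X τ ^ 3 + 1 - Y τ ^ 2)) := by
    refine tendsto_const_nhds.congr fun σ ↦ ?_
    have h := hconst _ τ.im_pos _ σ.im_pos
    simp only [Function.comp_apply, ofComplex_apply] at h
    exact h
  have h0 : X τ ^ 3 + 1 - Y τ ^ 2 = 0 := tendsto_nhds_unique hlim hT3
  linear_combination h0

/-- `x · q² → 1` at `i∞` (`x` has a double pole at the cusp `∞`: `Σ δ r_δ = −48`). [folklore] -/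
theorem tendsto_x36_mul_qParam_sq :
    Tendsto (fun τ : ℍ ↦ etaQuotient 36 (expFn [(6, -1), (12, 1), (18, 3), (36, -3)]) τ
      * Function.Periodic.qParam 1 (τ : ℂ) ^ (2 : ℤ)) atImInfty (𝓝 1) := by
  have h := tendsto_etaQuotient_div_qParam_zpow 36 (expFn [(6, -1), (12, 1), (18, 3), (36, -3)]) (-2)
    (by decide)
  refine h.congr fun τ ↦ ?_
  rw [zpow_neg, div_inv_eq_mul]

/-- Non-degeneracy: `4x³ − 0·x − (−4) ≠ 0` somewhere (else `x³ = −1`, but `x q² → 1`, `−q⁶ → 0`). [folklore] -/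
theorem exists_x36_nondegenerate :
    ∃ τ₀ : ℍ, 4 * etaQuotient 36 (expFn [(6, -1), (12, 1), (18, 3), (36, -3)]) τ₀ ^ 3
      - 0 * etaQuotient 36 (expFn [(6, -1), (12, 1), (18, 3), (36, -3)]) τ₀ - (-4) ≠ 0 := by
  by_contra hne
  push Not at hne
  set x : ℍ → ℂ := etaQuotient 36 (expFn [(6, -1), (12, 1), (18, 3), (36, -3)]) with hx
  have hx3 : ∀ τ : ℍ, x τ ^ 3 = -1 := fun τ ↦ by linear_combination (1 / 4 : ℂ) * hne τ
  have h1 : Tendsto (fun τ : ℍ ↦ (x τ * Function.Periodic.qParam 1 (τ : ℂ) ^ (2 : ℤ)) ^ 3) atImInfty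
      (𝓝 1) := by simpa using tendsto_x36_mul_qParam_sq.pow 3
  have h2 : Tendsto (fun τ : ℍ ↦ (x τ * Function.Periodic.qParam 1 (τ : ℂ) ^ (2 : ℤ)) ^ 3) atImInfty
      (𝓝 0) := by
    have h6 := (tendsto_qParam_zpow_atImInfty (m := 6) (by norm_num)).const_mul (-1 : ℂ)
    rw [mul_zero] at h6
    refine h6.congr fun τ ↦ ?_
    rw [mul_pow, hx3, ← zpow_natCast, ← zpow_mul]
    norm_num
  exact one_ne_zero (tendsto_nhds_unique h1 h2)

/-- **(S2)₃₆ from the two identities (I1), (I2a)**: the period lattice of `φ₃₆ = η(6τ)⁴` lies in the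
lattice of the Weierstrass pair with invariants `g₂ = 0`, `g₃ = −4` (the analytic bridge with
`(x′)² = (2πiφ₃₆)²(4x³ + 4)`). [cite: CremonaAlgorithms1997, §2.10] -/
theorem periodLatticeLeHex36_of_etaIdentities
    (h1 : ∀ τ : ℍ, etaQuotient 36 (expFn [(6, -1), (12, 1), (18, 3), (36, -3)]) τ ^ 3 + 1
      = etaQuotient 36 (expFn [(6, -2), (12, 4), (18, 2), (36, -4)]) τ ^ 2)
    (h2 : ∀ τ : ℍ, deriv (etaQuotient 36 (expFn [(6, -1), (12, 1), (18, 3), (36, -3)]) ∘ ofComplex) τ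
      = -(2 * π * I * cuspFormEtaProductThirtySix τ)
          * (2 * etaQuotient 36 (expFn [(6, -2), (12, 4), (18, 2), (36, -4)]) τ)) :
    ∃ L₁ : PeriodPair, L₁.g₂ = 0 ∧ L₁.g₃ = -4 ∧
      ∀ z ∈ periodLattice cuspFormEtaProductThirtySix, z ∈ L₁.lattice := by
  obtain ⟨L₁, hg2, hg3⟩ := PeriodPair.uniformization_holds 0 (-4) (by norm_num)
  refine ⟨L₁, hg2, hg3, periodLattice_le_of_deriv_sq cuspFormEtaProductThirtySix
    cuspFormEtaProductThirtySix_ne_zero L₁ _ (mdifferentiable_etaQuotient 36 _) x36_smul ?_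
    (by rw [hg2, hg3]; exact exists_x36_nondegenerate)⟩
  intro τ
  rw [h2 τ, hg2, hg3]
  linear_combination 4 * (2 * π * I * cuspFormEtaProductThirtySix τ) ^ 2 * (h1 τ).symm

/-- **(S2)₃₆ from the three limits (T1)–(T3).** [cite: Ligozat1975, Ch. 4] -/
theorem periodLatticeLeHex36_of_tendsto
    (hT1 : Tendsto (fun τ : ℍ ↦ ((2 * π * I)⁻¹
      * deriv (etaQuotient 36 (expFn [(6, -1), (12, 1), (18, 3), (36, -3)]) ∘ ofComplex) τ
      + cuspFormEtaProductThirtySix τ * (2 * etaQuotient 36 (expFn [(6, -2), (12, 4), (18, 2), (36, -4)]) τ))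
      / Function.Periodic.qParam 1 (τ : ℂ)) atImInfty (𝓝 0))
    (hT2 : Tendsto (fun τ : ℍ ↦ ((2 * π * I)⁻¹
      * deriv (etaQuotient 36 (expFn [(6, -2), (12, 4), (18, 2), (36, -4)]) ∘ ofComplex) τ
      + cuspFormEtaProductThirtySix τ * (3 * etaQuotient 36 (expFn [(6, -1), (12, 1), (18, 3), (36, -3)]) τ ^ 2))
      / Function.Periodic.qParam 1 (τ : ℂ)) atImInfty (𝓝 0))
    (hT3 : Tendsto (fun τ : ℍ ↦ etaQuotient 36 (expFn [(6, -1), (12, 1), (18, 3), (36, -3)]) τ ^ 3 + 1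
      - etaQuotient 36 (expFn [(6, -2), (12, 4), (18, 2), (36, -4)]) τ ^ 2) atImInfty (𝓝 0)) :
    ∃ L₁ : PeriodPair, L₁.g₂ = 0 ∧ L₁.g₃ = -4 ∧
      ∀ z ∈ periodLattice cuspFormEtaProductThirtySix, z ∈ L₁.lattice :=
  periodLatticeLeHex36_of_etaIdentities
    (cubic36_of_deriv (deriv_x36_of_tendsto hT1) (deriv_Y36_of_tendsto hT2) hT3) (deriv_x36_of_tendsto hT1)

/-- **`|c| = 1` on `X₀(36)` from the three limits**: for every globally minimal `W/ℚ` and every `X₀(36)`-datum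
`D` of `W` with the lattice clause, `|D.maninConstant| = 1` — the hexagonal squeeze with (S1)₃₆ proved and
(S2)₃₆ from (T1)–(T3).  No modularity, CDT or printed Manin-constant fact is assumed. [cite: Ligozat1975, Ch. 4] -/
theorem abs_maninConstant_eq_one_thirtySix_of_tendsto
    (hT1 : Tendsto (fun τ : ℍ ↦ ((2 * π * I)⁻¹
      * deriv (etaQuotient 36 (expFn [(6, -1), (12, 1), (18, 3), (36, -3)]) ∘ ofComplex) τ
      + cuspFormEtaProductThirtySix τ * (2 * etaQuotient 36 (expFn [(6, -2), (12, 4), (18, 2), (36, -4)]) τ))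
      / Function.Periodic.qParam 1 (τ : ℂ)) atImInfty (𝓝 0))
    (hT2 : Tendsto (fun τ : ℍ ↦ ((2 * π * I)⁻¹
      * deriv (etaQuotient 36 (expFn [(6, -2), (12, 4), (18, 2), (36, -4)]) ∘ ofComplex) τ
      + cuspFormEtaProductThirtySix τ * (3 * etaQuotient 36 (expFn [(6, -1), (12, 1), (18, 3), (36, -3)]) τ ^ 2))
      / Function.Periodic.qParam 1 (τ : ℂ)) atImInfty (𝓝 0))
    (hT3 : Tendsto (fun τ : ℍ ↦ etaQuotient 36 (expFn [(6, -1), (12, 1), (18, 3), (36, -3)]) τ ^ 3 + 1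
      - etaQuotient 36 (expFn [(6, -2), (12, 4), (18, 2), (36, -4)]) τ ^ 2) atImInfty (𝓝 0))
    (W : WeierstrassCurve ℚ) [W.IsGloballyMinimal] (D : ModularParametrizationData W 36)
    (hopt : ∀ z ∈ D.L.lattice, ∃ w ∈ periodLattice D.f, z = D.c * w) :
    |D.maninConstant| = 1 :=
  HexagonalSqueezeThirtySix.abs_maninConstant_eq_one_thirtySix_of_periodLattice_le_hex
    (periodLatticeLeHex36_of_tendsto hT1 hT2 hT3) W D hopt

end Summit.BirchSwinnertonDyer.BirchSwinnertonDyer.Theorems.ManinLocalTwoThree.EtaIdentityReductionThirtySix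

end
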